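import Mathlib
import Literature.Probability.LatticeModels.SharpnessProofs
import HarnessLib

/-!
# Stub `stub_coneTailMassOfStableTail` of line `diffusive-branch-is-nonsaturation` (crux
# `PrecisionLaplacian.DirectCorrelationStableTail`, stmt-CriticalPhenomena-4799): the cone tail
# mass of a stable tail

**Statement** (registered text).  Let `a : ℤ³ → ℝ` be nonnegative off the origin and suppose
`a(x)·|x|₂^{5−η} − Φ(x/|x|₂) → 0` along the cofinite filter, where `Φ` is continuous on the
Euclidean unit sphere `S² = {u : Fin 3 → ℝ | Σ uᵢ² = 1}` and `Φ(u₀) > 0` for some `u₀ ∈ S²`.  Then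
there are `c > 0` and `ρ₀` with `c·ρ^{−(2−η)} ≤ Σ_{y ∈ Λ_{2ρ} ∖ Λ_ρ} a(y)` for all `ρ ≥ ρ₀`
(`Λ_L = box 3 L = {−L,…,L}³`, so the shell is `{ρ < ‖y‖_∞ ≤ 2ρ}`).

**Proof** (elementary, Ising-free).  Continuity of `Φ` on `S²` at `u₀` gives `δ₁ > 0` with
`Φ > Φ(u₀)/2` on `S² ∩ {‖u − u₀‖_∞ < δ₁}`; cofinite convergence gives `N` with
`|a(x)|x|₂^{5−η} − Φ(x̂)| < Φ(u₀)/4` whenever `‖x‖_∞ > N`.  Let `i₀` maximise `|u₀ i|`, put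
`t = 3ρ/(2|u₀ i₀|)` (so `t·u₀` has sup norm `3ρ/2` and Euclidean norm `t ≥ 3ρ/2`), round `t·u₀`
coordinatewise to `z₀ ∈ ℤ³` and let `s = ⌊ρ/M⌋` for a large fixed integer `M`.  Every `y = z₀ + w`,
`w ∈ Λ_s`, is coordinatewise within `s + 1/2` of `t·u₀`, hence lies in `Λ_{2ρ} ∖ Λ_ρ`, has
`ρ ≤ |y|₂ ≤ 4ρ`, and its direction is within `4(s + 1/2)/t < δ₁` of `u₀` in each coordinate (from
`|t − |y|₂| ≤ 3(s + 1/2)`, via `t² − |y|₂² = Σ (t u₀ᵢ − yᵢ)(t u₀ᵢ + yᵢ)`).  So `a(y)·|y|₂^{5−η} > Φ(u₀)/4`,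
whence `a(y) ≥ (Φ(u₀)/4)·min(1, 4^{−(5−η)})·ρ^{−(5−η)}`, and summing over the `(2s+1)³ ≥ (ρ/M)³`
points of the translated cube gives the claim with `c = (Φ(u₀)/4)·min(1, 4^{−(5−η)})/M³`.
Pure theorem file, no definitions, no `sorry`.  References: folklore (elementary real analysis).
-/

noncomputable section

namespace Summit.CriticalPhenomena.Ising3DConformalLimit.Cruxes.DirectCorrelationStableTail.DiffusiveBranchIsNonsaturation

open Literature.Probability.LatticeModels
open scoped BigOperators

/-! ### Elementary real-analysis helpers -/

/-- A cone neighbourhood: continuity of `Φ` on the sphere at a point where `Φ > 0` gives a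
coordinatewise `δ`-neighbourhood on which `Φ > Φ(u₀)/2`. [folklore] -/
theorem coneTail_nbhd {Φ : (Fin 3 → ℝ) → ℝ} {u₀ : Fin 3 → ℝ}
    (hΦc : ContinuousOn Φ {u : Fin 3 → ℝ | ∑ i, u i ^ 2 = 1}) (hu₀ : ∑ i, u₀ i ^ 2 = 1)
    (h0 : 0 < Φ u₀) :
    ∃ δ : ℝ, 0 < δ ∧ ∀ u : Fin 3 → ℝ, ∑ i, u i ^ 2 = 1 → (∀ i, |u i - u₀ i| < δ) →
      Φ u₀ / 2 < Φ u := by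
  have h := hΦc u₀ hu₀
  rw [Metric.continuousWithinAt_iff] at h
  obtain ⟨δ, hδ, h⟩ := h (Φ u₀ / 2) (by linarith)
  refine ⟨δ, hδ, fun u hu hd => ?_⟩
  have hdist : dist u u₀ < δ := (dist_pi_lt_iff hδ).2 fun i => by rw [Real.dist_eq]; exact hd i
  have h' := h hu hdist
  rw [Real.dist_eq, abs_lt] at h'
  linarith [h'.1]

/-- A cofinitely-eventual property of lattice points holds outside a large sup-norm box.
[folklore] -/
theorem coneTail_eventually {P : Site 3 → Prop} (h : ∀ᶠ x in Filter.cofinite, P x) :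
    ∃ N : ℕ, ∀ x : Site 3, N < Site.supNorm x → P x := by
  rw [Filter.eventually_cofinite] at h
  refine ⟨h.toFinset.sup Site.supNorm, fun x hx => ?_⟩
  by_contra hP
  have hmem : x ∈ h.toFinset := h.mem_toFinset.2 hP
  have := Finset.le_sup (f := Site.supNorm) hmem
  omega

/-- Comparison of negative powers on a bounded ratio: if `r ≤ q ≤ 4r` then
`min(1, 4^{-p})·r^{-p} ≤ q^{-p}` for every real `p`. [folklore] -/
theorem coneTail_rpow_lower {p r q : ℝ} (hr : 0 < r) (hrq : r ≤ q) (hq4 : q ≤ 4 * r) :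
    min 1 ((4 : ℝ) ^ (-p)) * r ^ (-p) ≤ q ^ (-p) := by
  have hq : 0 < q := lt_of_lt_of_le hr hrq
  rcases le_or_gt 0 p with hp | hp
  · calc min 1 ((4 : ℝ) ^ (-p)) * r ^ (-p) ≤ (4 : ℝ) ^ (-p) * r ^ (-p) :=
          mul_le_mul_of_nonneg_right (min_le_right _ _) (Real.rpow_nonneg hr.le _)
      _ = (4 * r) ^ (-p) := (Real.mul_rpow (by norm_num) hr.le).symm
      _ ≤ q ^ (-p) := Real.rpow_le_rpow_of_nonpos hq hq4 (by linarith)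
  · calc min 1 ((4 : ℝ) ^ (-p)) * r ^ (-p) ≤ 1 * r ^ (-p) :=
          mul_le_mul_of_nonneg_right (min_le_left _ _) (Real.rpow_nonneg hr.le _)
      _ = r ^ (-p) := one_mul _
      _ ≤ q ^ (-p) := Real.rpow_le_rpow hr.le hrq (by linarith)

/-- A coordinate is bounded by the Euclidean length `E` (`E > 0`, `E² = Σ yᵢ²`). [folklore] -/
theorem coneTail_abs_le {y : Fin 3 → ℝ} {E : ℝ} (hE : 0 < E) (hE2 : E ^ 2 = ∑ i, y i ^ 2)
    (i : Fin 3) : |y i| ≤ E := by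
  have h : y i ^ 2 ≤ ∑ j, y j ^ 2 :=
    Finset.single_le_sum (f := fun j => y j ^ 2) (fun j _ => sq_nonneg _) (Finset.mem_univ i)
  rw [← hE2] at h
  simpa [abs_of_pos hE] using sq_le_sq.1 h

/-- If `y` is coordinatewise within `r` of `t·u₀` (`|u₀|₂ = 1`, `t > 0`) and `E = |y|₂`, then
`|t − E| ≤ 3r` (via `t² − E² = Σ (t u₀ᵢ − yᵢ)(t u₀ᵢ + yᵢ)`). [folklore] -/
theorem coneTail_abs_sub_le {u₀ y : Fin 3 → ℝ} {t E r : ℝ} (hu₀ : ∑ i, u₀ i ^ 2 = 1)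
    (ht : 0 < t) (hE : 0 < E) (hE2 : E ^ 2 = ∑ i, y i ^ 2) (hr : ∀ i, |y i - t * u₀ i| ≤ r) :
    |t - E| ≤ 3 * r := by
  have hui : ∀ i, |u₀ i| ≤ 1 := coneTail_abs_le one_pos (by rw [one_pow, hu₀])
  have hyi : ∀ i, |y i| ≤ E := coneTail_abs_le hE hE2
  have hterm : ∀ i, |(t * u₀ i) ^ 2 - y i ^ 2| ≤ r * (t + E) := fun i => by
    rw [sq_sub_sq, abs_mul]
    have h1 : |t * u₀ i + y i| ≤ t + E := by
      calc |t * u₀ i + y i| ≤ |t * u₀ i| + |y i| := abs_add_le _ _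
        _ ≤ t + E := by
            refine add_le_add ?_ (hyi i)
            rw [abs_mul, abs_of_pos ht]
            nlinarith [hui i]
    have h2 : |t * u₀ i - y i| ≤ r := by rw [abs_sub_comm]; exact hr i
    calc |t * u₀ i + y i| * |t * u₀ i - y i| ≤ (t + E) * r :=
          mul_le_mul h1 h2 (abs_nonneg _) (by positivity)
      _ = r * (t + E) := mul_comm _ _
  have hsum : (t - E) * (t + E) = ∑ i, ((t * u₀ i) ^ 2 - y i ^ 2) := by
    rw [Finset.sum_sub_distrib, ← hE2]
    have : ∑ i, (t * u₀ i) ^ 2 = t ^ 2 := by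
      simp_rw [mul_pow]
      rw [← Finset.mul_sum, hu₀, mul_one]
    rw [this]
    ring
  have habs : |t - E| * (t + E) ≤ 3 * r * (t + E) := by
    have h1 : |(t - E) * (t + E)| ≤ ∑ i, |(t * u₀ i) ^ 2 - y i ^ 2| := by
      rw [hsum]
      exact Finset.abs_sum_le_sum_abs _ _
    have h2 : ∑ i, |(t * u₀ i) ^ 2 - y i ^ 2| ≤ ∑ _i : Fin 3, r * (t + E) :=
      Finset.sum_le_sum fun i _ => hterm i
    rw [Finset.sum_const, Finset.card_univ, Fintype.card_fin, nsmul_eq_mul] at h2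
    rw [abs_mul, abs_of_pos (by positivity : 0 < t + E)] at h1
    push_cast at h2
    linarith
  exact le_of_mul_le_mul_right habs (by positivity)

/-- Direction estimate: under the hypotheses of `coneTail_abs_sub_le`, each coordinate of the
direction `y/|y|₂` is within `4r/t` of `u₀`. [folklore] -/
theorem coneTail_abs_div_sub_le {u₀ y : Fin 3 → ℝ} {t E r : ℝ} (hu₀ : ∑ i, u₀ i ^ 2 = 1)
    (ht : 0 < t) (hE : 0 < E) (hE2 : E ^ 2 = ∑ i, y i ^ 2) (hr : ∀ i, |y i - t * u₀ i| ≤ r)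
    (i : Fin 3) : |y i / E - u₀ i| ≤ 4 * r / t := by
  have htE := coneTail_abs_sub_le hu₀ ht hE hE2 hr
  have hyi : |y i| ≤ E := coneTail_abs_le hE hE2 i
  have htne : t ≠ 0 := ht.ne'
  have hEne : E ≠ 0 := hE.ne'
  have key : y i / E - u₀ i = (y i - t * u₀ i) / t + (y i / E) * ((t - E) / t) := by
    field_simp
    ring
  rw [key]
  calc |(y i - t * u₀ i) / t + (y i / E) * ((t - E) / t)|
      ≤ |(y i - t * u₀ i) / t| + |(y i / E) * ((t - E) / t)| := abs_add_le _ _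
    _ = |y i - t * u₀ i| / t + |y i| / E * (|t - E| / t) := by
        rw [abs_mul, abs_div, abs_div, abs_div, abs_of_pos ht, abs_of_pos hE]
    _ ≤ r / t + 1 * (3 * r / t) := by
        refine add_le_add (div_le_div_of_nonneg_right (hr i) ht.le)
          (mul_le_mul ?_ (div_le_div_of_nonneg_right htE ht.le) (by positivity) zero_le_one)
        rwa [div_le_one hE]
    _ = 4 * r / t := by ring

/-! ### Lattice geometry of the translated cube -/

/-- The translated cube: if `z₀` is the coordinatewise rounding of `t·u₀` (sup norm of `t·u₀`
equal to `3ρ/2`, attained at `i₀`), `w ∈ Λ_s` with `4s ≤ ρ`, `ρ ≥ 3`, and `y = z₀ + w`, then `y` is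
coordinatewise within `s + 1/2` of `t·u₀`, lies in the shell `Λ_{2ρ} ∖ Λ_ρ`, and `|y i₀| > ρ`.
[folklore] -/
theorem coneTail_cube {u₀ : Fin 3 → ℝ} {i₀ : Fin 3} (hi₀ : ∀ i, |u₀ i| ≤ |u₀ i₀|) {t : ℝ}
    (ht : 0 < t) {ρ s : ℕ} (hti₀ : t * |u₀ i₀| = 3 * ρ / 2) {z₀ w y : Site 3}
    (hz₀ : ∀ i, |(z₀ i : ℝ) - t * u₀ i| ≤ 1 / 2) (hρ : 3 ≤ ρ) (hs : 4 * s ≤ ρ)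
    (hw : w ∈ box 3 s) (hy : ∀ i, y i = z₀ i + w i) :
    (∀ i, |(y i : ℝ) - t * u₀ i| ≤ s + 1 / 2) ∧ y ∈ box 3 (2 * ρ) \ box 3 ρ ∧
      (ρ : ℝ) < |(y i₀ : ℝ)| := by
  rw [mem_box] at hw
  have hw' : ∀ i, |((w i : ℤ) : ℝ)| ≤ s := fun i =>
    abs_le.2 ⟨by exact_mod_cast (hw i).1, by exact_mod_cast (hw i).2⟩
  have hρ' : (3 : ℝ) ≤ ρ := by exact_mod_cast hρ
  have hs' : 4 * (s : ℝ) ≤ ρ := by exact_mod_cast hs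
  have htu : ∀ i, |t * u₀ i| ≤ 3 * ρ / 2 := fun i => by
    rw [abs_mul, abs_of_pos ht, ← hti₀]
    exact mul_le_mul_of_nonneg_left (hi₀ i) ht.le
  have hdev : ∀ i, |(y i : ℝ) - t * u₀ i| ≤ s + 1 / 2 := fun i => by
    have : (y i : ℝ) - t * u₀ i = ((z₀ i : ℝ) - t * u₀ i) + (w i : ℝ) := by
      rw [hy i]
      push_cast
      ring
    rw [this]
    calc |((z₀ i : ℝ) - t * u₀ i) + (w i : ℝ)| ≤ |(z₀ i : ℝ) - t * u₀ i| + |((w i : ℤ) : ℝ)| :=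
          abs_add_le _ _
      _ ≤ 1 / 2 + s := add_le_add (hz₀ i) (hw' i)
      _ = s + 1 / 2 := add_comm _ _
  have hyabs : ∀ i, |(y i : ℝ)| ≤ 2 * ρ := fun i => by
    have : ((y i : ℤ) : ℝ) = (((y i : ℤ) : ℝ) - t * u₀ i) + t * u₀ i := by ring
    rw [this]
    calc |(((y i : ℤ) : ℝ) - t * u₀ i) + t * u₀ i| ≤ |((y i : ℤ) : ℝ) - t * u₀ i| + |t * u₀ i| :=
          abs_add_le _ _
      _ ≤ (s + 1 / 2) + 3 * ρ / 2 := add_le_add (hdev i) (htu i)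
      _ ≤ 2 * ρ := by linarith
  have hyi₀ : (ρ : ℝ) < |(y i₀ : ℝ)| := by
    have h1 := hdev i₀
    have h2 : |t * u₀ i₀| = 3 * ρ / 2 := by rw [abs_mul, abs_of_pos ht, hti₀]
    have h3 := abs_sub_abs_le_abs_sub (t * u₀ i₀) ((y i₀ : ℤ) : ℝ)
    rw [abs_sub_comm] at h3
    linarith
  refine ⟨hdev, ?_, hyi₀⟩
  rw [Finset.mem_sdiff, mem_box, mem_box]
  constructor
  · intro i
    have h := abs_le.1 (hyabs i)
    exact ⟨by exact_mod_cast h.1, by exact_mod_cast h.2⟩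
  · intro h
    have h1 : -(ρ : ℝ) ≤ ((y i₀ : ℤ) : ℝ) := by exact_mod_cast (h i₀).1
    have h2 : ((y i₀ : ℤ) : ℝ) ≤ ρ := by exact_mod_cast (h i₀).2
    have := abs_le.2 ⟨h1, h2⟩
    linarith

/-- Euclidean length of a shell point: `ρ ≤ |y|₂ ≤ 4ρ` when `y ∈ Λ_{2ρ}` and `|y i₀| > ρ`.
[folklore] -/
theorem coneTail_sqrt_bounds {ρ : ℕ} {y : Site 3} {i₀ : Fin 3} (hmem : y ∈ box 3 (2 * ρ))
    (hyi₀ : (ρ : ℝ) < |(y i₀ : ℝ)|) :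
    (ρ : ℝ) ≤ Real.sqrt (∑ j, ((y j : ℝ)) ^ 2) ∧ Real.sqrt (∑ j, ((y j : ℝ)) ^ 2) ≤ 4 * ρ := by
  rw [mem_box] at hmem
  constructor
  · have h : ((y i₀ : ℝ)) ^ 2 ≤ ∑ j, ((y j : ℝ)) ^ 2 :=
      Finset.single_le_sum (f := fun j => ((y j : ℝ)) ^ 2) (fun j _ => sq_nonneg _)
        (Finset.mem_univ i₀)
    exact hyi₀.le.trans (Real.abs_le_sqrt h)
  · have h : ∑ j, ((y j : ℝ)) ^ 2 ≤ (4 * (ρ : ℝ)) ^ 2 := by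
      have h1 : ∀ j, ((y j : ℝ)) ^ 2 ≤ (2 * (ρ : ℝ)) ^ 2 := fun j => by
        obtain ⟨h2, h3⟩ := hmem j
        have h2' : -(2 * (ρ : ℝ)) ≤ (y j : ℝ) := by exact_mod_cast h2
        have h3' : ((y j : ℝ)) ≤ 2 * ρ := by exact_mod_cast h3
        exact sq_le_sq' h2' h3'
      calc ∑ j, ((y j : ℝ)) ^ 2 ≤ ∑ _j : Fin 3, (2 * (ρ : ℝ)) ^ 2 :=
            Finset.sum_le_sum fun j _ => h1 j
        _ = 3 * (2 * (ρ : ℝ)) ^ 2 := by simp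
        _ ≤ (4 * (ρ : ℝ)) ^ 2 := by nlinarith
    calc Real.sqrt (∑ j, ((y j : ℝ)) ^ 2) ≤ Real.sqrt ((4 * (ρ : ℝ)) ^ 2) := Real.sqrt_le_sqrt h
      _ = 4 * ρ := Real.sqrt_sq (by positivity)

/-! ### The pointwise lower bound and the main theorem -/

/-- The pointwise bound: at a lattice point `y` with `ρ ≤ |y|₂ ≤ 4ρ`, coordinatewise within `r`
of `t·u₀` with `4r/t < δ₁`, and where the tail approximation holds to within `φ₀/4`, one has
`a(y) ≥ (φ₀/4)·min(1,4^{-p})·ρ^{-p}`. [folklore] -/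
theorem coneTail_point {a : Site 3 → ℝ} {Φ : (Fin 3 → ℝ) → ℝ} {u₀ : Fin 3 → ℝ}
    {p φ₀ δ₁ t r : ℝ} {ρ : ℕ} {y : Site 3} (hu₀ : ∑ i, u₀ i ^ 2 = 1)
    (hcone : ∀ u : Fin 3 → ℝ, ∑ i, u i ^ 2 = 1 → (∀ i, |u i - u₀ i| < δ₁) → φ₀ / 2 < Φ u)
    (hφ₀ : 0 < φ₀)
    (hN : |a y * Real.sqrt (∑ j, ((y j : ℝ)) ^ 2) ^ p -
        Φ (fun i => (y i : ℝ) / Real.sqrt (∑ j, ((y j : ℝ)) ^ 2))| < φ₀ / 4)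
    (ht : 0 < t) (hr : ∀ i, |(y i : ℝ) - t * u₀ i| ≤ r) (hrt : 4 * r / t < δ₁)
    (hρ : (0 : ℝ) < ρ) (hlow : (ρ : ℝ) ≤ Real.sqrt (∑ j, ((y j : ℝ)) ^ 2))
    (hup : Real.sqrt (∑ j, ((y j : ℝ)) ^ 2) ≤ 4 * ρ) :
    φ₀ / 4 * min 1 ((4 : ℝ) ^ (-p)) * (ρ : ℝ) ^ (-p) ≤ a y := by
  set E : ℝ := Real.sqrt (∑ j, ((y j : ℝ)) ^ 2) with hEdef
  have hE : 0 < E := lt_of_lt_of_le hρ hlow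
  have hE2 : E ^ 2 = ∑ j, ((y j : ℝ)) ^ 2 :=
    Real.sq_sqrt (Finset.sum_nonneg fun j _ => sq_nonneg _)
  have hS : ∑ i, ((y i : ℝ) / E) ^ 2 = 1 := by
    simp_rw [div_pow]
    rw [← Finset.sum_div, ← hE2, div_self (pow_pos hE 2).ne']
  have hdir : ∀ i, |(y i : ℝ) / E - u₀ i| < δ₁ := fun i =>
    lt_of_le_of_lt (coneTail_abs_div_sub_le hu₀ ht hE hE2 hr i) hrt
  have hΦ := hcone _ hS hdir
  have h1 : φ₀ / 4 < a y * E ^ p := by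
    have := (abs_lt.1 hN).1
    linarith
  have hEp : 0 < E ^ p := Real.rpow_pos_of_pos hE p
  have h2 : a y = (a y * E ^ p) * E ^ (-p) := by
    rw [Real.rpow_neg hE.le, mul_inv_cancel_right₀ hEp.ne']
  rw [h2]
  have h3 := coneTail_rpow_lower (p := p) hρ hlow hup
  have h4 : 0 ≤ min 1 ((4 : ℝ) ^ (-p)) * (ρ : ℝ) ^ (-p) := by positivity
  calc φ₀ / 4 * min 1 ((4 : ℝ) ^ (-p)) * (ρ : ℝ) ^ (-p)
      = φ₀ / 4 * (min 1 ((4 : ℝ) ^ (-p)) * (ρ : ℝ) ^ (-p)) := by ring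
    _ ≤ (a y * E ^ p) * E ^ (-p) := mul_le_mul h1.le h3 h4 (by linarith)

/-- **Stub 5 `stub_coneTailMassOfStableTail` (cone tail mass of a stable tail; Ising-free).**  If
`a ≥ 0` off `0` and `a(x)|x|₂^{5−η} − Φ(x̂) → 0` cofinitely with `Φ` continuous on `S²` and
`Φ(u₀) > 0` somewhere, then the mass of `a` in the sup-norm shell `{ρ < ‖y‖ ≤ 2ρ}` is
`≥ c ρ^{−(2−η)}` for large `ρ`: a lattice cube of side `≍ ρ/M` inside the shell and inside the
cone `{x̂ : Φ(x̂) > Φ(u₀)/2}` carries `≍ (ρ/M)³` points with `a ≥ (Φ(u₀)/4)·min(1,4^{−(5−η)})·ρ^{−(5−η)}`.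
[folklore] -/
theorem stub_coneTailMassOfStableTail :
    ∀ (a : Site 3 → ℝ) (η : ℝ) (Φ : (Fin 3 → ℝ) → ℝ), 0 < η → (∀ y, y ≠ 0 → 0 ≤ a y) →
      ContinuousOn Φ {u : Fin 3 → ℝ | ∑ i, u i ^ 2 = 1} → (∃ u : Fin 3 → ℝ, ∑ i, u i ^ 2 = 1 ∧ 0 < Φ u) →
      Filter.Tendsto (fun x : Site 3 => a x * Real.sqrt (∑ j, ((x j : ℝ)) ^ 2) ^ (5 - η) -
        Φ (fun i => (x i : ℝ) / Real.sqrt (∑ j, ((x j : ℝ)) ^ 2))) Filter.cofinite (nhds 0) →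
      ∃ (c : ℝ) (ρ₀ : ℕ), 0 < c ∧ ∀ ρ : ℕ, ρ₀ ≤ ρ →
        c * (ρ : ℝ) ^ (-(2 - η)) ≤ ∑ y ∈ box 3 (2 * ρ) \ box 3 ρ, a y := by
  intro a η Φ _hη ha hΦc hex hT
  obtain ⟨u₀, hu₀, hΦ0⟩ := hex
  -- (1) the cone neighbourhood of `u₀`
  obtain ⟨δ₁, hδ₁, hcone⟩ := coneTail_nbhd hΦc hu₀ hΦ0
  -- (2) the tail approximation beyond a sup-norm radius `N`
  have hev : ∀ᶠ x : Site 3 in Filter.cofinite,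
      |a x * Real.sqrt (∑ j, ((x j : ℝ)) ^ 2) ^ (5 - η) -
        Φ (fun i => (x i : ℝ) / Real.sqrt (∑ j, ((x j : ℝ)) ^ 2))| < Φ u₀ / 4 := by
    have h := Metric.tendsto_nhds.1 hT (Φ u₀ / 4) (by linarith)
    filter_upwards [h] with x hx
    rwa [Real.dist_0_eq_abs] at hx
  obtain ⟨N, hN⟩ := coneTail_eventually hev
  -- (3) the maximal coordinate of `u₀`
  obtain ⟨i₀, -, hi₀⟩ :=
    Finset.exists_max_image Finset.univ (fun i => |u₀ i|) Finset.univ_nonempty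
  have hi₀' : ∀ i, |u₀ i| ≤ |u₀ i₀| := fun i => hi₀ i (Finset.mem_univ i)
  have hm₀le : |u₀ i₀| ≤ 1 := coneTail_abs_le one_pos (by rw [one_pow, hu₀]) i₀
  have hm₀pos : 0 < |u₀ i₀| := by
    by_contra hneg
    have h0 : ∀ i, u₀ i = 0 := fun i =>
      abs_nonpos_iff.1 ((hi₀' i).trans (not_lt.1 hneg))
    simp [h0] at hu₀
  -- constants: the cube scale `M` and the threshold `ρ₀`
  obtain ⟨M₁, hM₁⟩ := exists_nat_gt (16 / (3 * δ₁))
  obtain ⟨R₁, hR₁⟩ := exists_nat_gt (8 / (3 * δ₁))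
  obtain ⟨M, hM4, hMδ⟩ : ∃ M : ℕ, 4 ≤ M ∧ 16 / (3 * δ₁) < M :=
    ⟨M₁ + 4, by omega, hM₁.trans_le (by exact_mod_cast Nat.le_add_right M₁ 4)⟩
  have hM0 : 0 < M := by omega
  have hMpos : (0 : ℝ) < M := by exact_mod_cast hM0
  set p : ℝ := 5 - η with hp
  refine ⟨Φ u₀ / 4 * min 1 ((4 : ℝ) ^ (-p)) / (M : ℝ) ^ 3, N + R₁ + 3, by positivity,
    fun ρ hρ => ?_⟩
  have hρN : N ≤ ρ := by omega
  have hρ3 : 3 ≤ ρ := by omega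
  have hρpos : (0 : ℝ) < ρ := by positivity
  have hρδ : 8 / (3 * δ₁) < ρ := hR₁.trans_le (by exact_mod_cast (by omega : R₁ ≤ ρ))
  -- the cube side `s = ⌊ρ/M⌋`
  obtain ⟨s, hsM, hsM1⟩ : ∃ s : ℕ, s * M ≤ ρ ∧ ρ < (s + 1) * M :=
    ⟨ρ / M, Nat.div_mul_le_self ρ M, by rw [mul_comm]; exact Nat.lt_mul_div_succ ρ hM0⟩
  have hs4 : 4 * s ≤ ρ :=
    calc 4 * s ≤ M * s := Nat.mul_le_mul_right s hM4
      _ = s * M := mul_comm _ _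
      _ ≤ ρ := hsM
  have hsM' : (s : ℝ) * M ≤ ρ := by exact_mod_cast hsM
  have hsM1' : (ρ : ℝ) < ((s : ℝ) + 1) * M := by exact_mod_cast hsM1
  -- the scale `t` with `t·|u₀ i₀| = 3ρ/2`
  obtain ⟨t, ht_def⟩ : ∃ t : ℝ, t = 3 * ρ / (2 * |u₀ i₀|) := ⟨_, rfl⟩
  have ht : 0 < t := by rw [ht_def]; positivity
  have hti₀ : t * |u₀ i₀| = 3 * ρ / 2 := by
    rw [ht_def]
    field_simp
  have ht32 : 3 * (ρ : ℝ) / 2 ≤ t := by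
    rw [ht_def, div_le_div_iff₀ two_pos (by positivity)]
    nlinarith
  -- the rounded centre `z₀`
  obtain ⟨z₀, hz₀⟩ : ∃ z₀ : Site 3, ∀ i, |(z₀ i : ℝ) - t * u₀ i| ≤ 1 / 2 :=
    ⟨fun i => round (t * u₀ i), fun i => by rw [abs_sub_comm]; exact abs_sub_round _⟩
  -- the direction threshold `4(s + 1/2)/t < δ₁`
  have hrt : 4 * ((s : ℝ) + 1 / 2) / t < δ₁ := by
    rw [div_lt_iff₀ ht]
    have h1 : (16 : ℝ) < 3 * δ₁ * M := by
      have := (div_lt_iff₀ (by positivity : (0 : ℝ) < 3 * δ₁)).1 hMδ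
      linarith
    have h2 : (8 : ℝ) < 3 * δ₁ * ρ := by
      have := (div_lt_iff₀ (by positivity : (0 : ℝ) < 3 * δ₁)).1 hρδ
      linarith
    have h7 : (4 * ((s : ℝ) + 1 / 2)) * M < (3 * δ₁ * ρ / 2) * M := by
      nlinarith [mul_lt_mul_of_pos_right h1 hρpos, mul_lt_mul_of_pos_right h2 hMpos]
    have h8 : 4 * ((s : ℝ) + 1 / 2) < 3 * δ₁ * ρ / 2 := lt_of_mul_lt_mul_right h7 hMpos.le
    have h9 : δ₁ * (3 * (ρ : ℝ) / 2) ≤ δ₁ * t := mul_le_mul_of_nonneg_left ht32 hδ₁.le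
    linarith
  -- per-point facts on the translated cube `z₀ + Λ_s`
  have key : ∀ w ∈ box 3 s, z₀ + w ∈ box 3 (2 * ρ) \ box 3 ρ ∧
      Φ u₀ / 4 * min 1 ((4 : ℝ) ^ (-p)) * (ρ : ℝ) ^ (-p) ≤ a (z₀ + w) := by
    intro w hw
    obtain ⟨hdev, hmem, hyi₀⟩ :=
      coneTail_cube (y := z₀ + w) hi₀' ht hti₀ hz₀ hρ3 hs4 hw (fun i => rfl)
    refine ⟨hmem, ?_⟩
    obtain ⟨hlow, hup⟩ := coneTail_sqrt_bounds (Finset.mem_sdiff.1 hmem).1 hyi₀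
    have hsup : N < Site.supNorm (z₀ + w) := by
      have h := (Finset.mem_sdiff.1 hmem).2
      rw [mem_box_iff_supNorm_le, not_le] at h
      omega
    exact coneTail_point hu₀ hcone hΦ0 (hN _ hsup) ht hdev hrt hρpos hlow hup
  -- summation
  have hexp : (ρ : ℝ) ^ (-(2 - η)) = (ρ : ℝ) ^ 3 * (ρ : ℝ) ^ (-p) := by
    rw [← Real.rpow_natCast, ← Real.rpow_add hρpos]
    congr 1
    rw [hp]
    push_cast
    ring
  have hK : 0 ≤ Φ u₀ / 4 * min 1 ((4 : ℝ) ^ (-p)) * (ρ : ℝ) ^ (-p) := by positivity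
  calc Φ u₀ / 4 * min 1 ((4 : ℝ) ^ (-p)) / (M : ℝ) ^ 3 * (ρ : ℝ) ^ (-(2 - η))
      = ((ρ : ℝ) / M) ^ 3 * (Φ u₀ / 4 * min 1 ((4 : ℝ) ^ (-p)) * (ρ : ℝ) ^ (-p)) := by
        rw [hexp]
        ring
    _ ≤ ((2 * s + 1 : ℕ) : ℝ) ^ 3 * (Φ u₀ / 4 * min 1 ((4 : ℝ) ^ (-p)) * (ρ : ℝ) ^ (-p)) := by
        have h1 : (ρ : ℝ) / M ≤ ((2 * s + 1 : ℕ) : ℝ) := by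
          rw [div_le_iff₀ hMpos]
          push_cast
          nlinarith
        exact mul_le_mul_of_nonneg_right (pow_le_pow_left₀ (by positivity) h1 3) hK
    _ = ∑ _w ∈ box 3 s, Φ u₀ / 4 * min 1 ((4 : ℝ) ^ (-p)) * (ρ : ℝ) ^ (-p) := by
        rw [Finset.sum_const, card_box, nsmul_eq_mul]
        push_cast
        ring
    _ ≤ ∑ w ∈ box 3 s, a (z₀ + w) := Finset.sum_le_sum fun w hw => (key w hw).2
    _ = ∑ y ∈ (box 3 s).image (fun w => z₀ + w), a y := by
        rw [Finset.sum_image]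
        intro x _ y _ h
        exact add_left_cancel h
    _ ≤ ∑ y ∈ box 3 (2 * ρ) \ box 3 ρ, a y := by
        apply Finset.sum_le_sum_of_subset_of_nonneg
        · exact Finset.image_subset_iff.2 fun w hw => (key w hw).1
        · intro y hy _
          refine ha y ?_
          rintro rfl
          exact (Finset.mem_sdiff.1 hy).2 (zero_mem_box 3 ρ)

end Summit.CriticalPhenomena.Ising3DConformalLimit.Cruxes.DirectCorrelationStableTail.DiffusiveBranchIsNonsaturation
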